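import Literature.Barriers.CriticalPhenomena.RigorousRGSmallParameterCovarianceParseval
import Literature.Barriers.CriticalPhenomena.WeaklySAWFourDimLogCorrectionsReduction
import HarnessLib

/-!
# BBS 2015, §6.1 and Lemma 8.3.1: the sequence `β_j = 8Σ_x(w_{j+1,x}² - w_{j,x}²)` of the weakly
# self-avoiding walk for the explicit finite-range decomposition, and `Σ_{j≥0} β_j = 𝖡_{m²}`

Companion ("proof architecture") file of `WeaklySAWFourDimLogCorrections.lean` (the barrier /
named fact `CTWSAW.BBS2015_thm11`, Theorem 1.1 of Bauerschmidt–Brydges–Slade, *Logarithmic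
correction for the susceptibility of the 4-dimensional weakly self-avoiding walk: a
renormalisation group analysis*, CMP 337 (2015), arXiv:1403.7422) and of
`WeaklySAWFourDimLogCorrectionsReduction.lean` (`CTWSAW.freeBubble d m² = 𝖡_{m²}` of (1.8), the
named fact `CTWSAW.BBS2015_thm41` = Theorem 4.1, whose second display carries the factor
`(ĝ₀𝖡_{m²})^{-γ}`). In the proof of Theorem 4.1 (§8.3–8.4) "the bubble diagram `𝖡_{m²} = 8B_{m²}`
defined in (1.8), with its logarithmic divergence in `d = 4`, enters via Lemmas 8.3.1–8.3.2":
Lemma 8.3.2 (`ǧ_∞ ∼ 1/𝖡_{m²}`, whose mechanism `ǧ_∞Σ_jβ_j → 1` is the tree's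
`CTWSAW.GchHyp.tendsto_limUnder_mul_tsum`, file `WeaklySAWCouplingFlowRemainder.lean`) consumes
**Lemma 8.3.1**, `Σ_{j=0}^∞ β_j = 𝖡_{m²}` for `m² > 0`, for the sequence `β_j` of §6.1:

  "The sequence `(β_j)_{0≤j<∞}` plays a key role in the analysis. It is defined in [BBS-rg-pt] by
  `β_j = 8Σ_{x∈ℤ^d}(w_{j+1,x}² - w_{j,x}²)`, with `w_{j,x} = Σ_{i=1}^j C_{i;0,x}`. The
  `m²`-dependence of `β_j` is suppressed in the notation. Since each `C_i` is positive-definite,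
  the above definition implies that `β_j > 0` for all `j`. … for `m² > 0`, by (scaling-estimate),
  `β_j` decays extremely rapidly to `0` for `j ≥ j_m`" (§6.1);

  "**Lemma 8.3.1.** For `m² > 0`, `Σ_{j=0}^∞ β_j = 𝖡_{m²}`. *Proof.* By the definition of `β_j`,
  `Σ_{j=0}^{k-1} β_j = 8Σ_{x∈ℤ^d} w_k(x)²`, since the left-hand side is a telescoping sum. Since
  the terms in the covariance decomposition are positive definite, the Fourier transforms satisfy
  `0 ≤ ŵ_k ≤ Ĉ`, where `C = (-Δ_{ℤ^d}+m²)⁻¹` is the Green function on `ℤ^d`. By the Parseval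
  relation, the dominated converge theorem, and (1.8),
  `lim_{k→∞} Σ_x w_k(x)² = lim_{k→∞} ∫_{[-π,π]^d} ŵ_k(p)² dp/(2π)^d = ∫_{[-π,π]^d} Ĉ(p)² dp/(2π)^d
  = B_{m²}`. Since `𝖡_{m²} = 8B_{m²}`, the proof is complete." (§8.3).

Here `(C_j)_{j≥1}` is the explicit finite-range decomposition of `(-Δ_{ℤ^d}+m²)⁻¹` of [Baue13a]
as in BBS's book (LNM 2242, Ch. 3) — the decomposition "defined and discussed in detail in
[BBS-rg-pt], based on [Baue13a]" (§5.1) — which the tree has as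
`LongRangePhi4.FRD.Gam d L m² j` (`RigorousRGSmallParameterFRDDecomposition.lean` and sequels:
`hasSum_Gam` = "`(-Δ_{ℤ^d}+m²)⁻¹ = Σ_{j≥1}C_j`", `Gam_posSemidef`, the finite-range property
`Gam_eq_zero`, the positivity `wHat_nonneg` of the Fourier side, the Parseval identity
`sum_mul_eq_setIntegral_cosSeries` and the inversion `wHat_eq_sum_wKer_mul_cos`).

## What this file proves (everything; no named fact is introduced)

* `covSum d L m² j x` (`w_{j,x} = Σ_{i=1}^j C_{i;0,x}`) and `betaPT d L m² j` (`β_j`) — the two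
  printed definitions, for the explicit decomposition; `covSum_eq_zero` (finite range of `w_j`:
  `w_{j,x} = 0` for `|x|₁ ≥ ½L^j`), `tsum_sq_sub_sq_eq_sum` (the sum over `ℤ^d` is finite).
* **`sum_range_betaPT`** — "`Σ_{j=0}^{k-1} β_j = 8Σ_x w_k(x)²`, since the left-hand side is a
  telescoping sum".
* The Fourier side: `GamHat` (`Ĉ_j(p) = ∫_{J_j} ŵ(t,p)dt/t ≥ 0`), `covSumHat` (`ŵ_k = Σ_{i≤k}Ĉ_i`),
  `hasSum_GamHat` (`Σ_jĈ_j = Ĉ = 1/(λ(p)+m²)`), hence **`0 ≤ ŵ_k ≤ Ĉ`** (`covSumHat_nonneg`,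
  `covSumHat_le`) with `ŵ_k ↑ Ĉ` (`covSumHat_mono`, `tendsto_covSumHat`); the identification
  `cosSeries_covSum` (`Σ_x w_k(x)cos(p·x) = ŵ_k(p)`) and **Parseval** `sum_covSum_sq_eq`
  (`Σ_x w_k(x)² = ∫_{[-π,π]^d} ŵ_k(p)² dp/(2π)^d`).
* `betaPT_eq_integral`, **`betaPT_nonneg`** (`β_j = 8∫(ŵ_{j+1}² - ŵ_j²)dp/(2π)^d ≥ 0`; the source's
  "`β_j > 0`" in the non-strict form used below).
* `freeBubble_eq_integral_laplaceSymbol` (`𝖡_{m²} = 8∫Ĉ(p)²dp/(2π)^d`, i.e. (1.8) in the symbol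
  `λ(k) = 4Σ_j sin²(k_j/2)` of `LongRangePhi4.laplaceSymbol`), `tendsto_integral_covSumHat_sq`
  (dominated convergence), `tendsto_sum_range_betaPT`, and
  **`hasSum_betaPT` / `BBS2015_lem831`** — **Lemma 8.3.1, PROVED**: `Σ_{j≥0} β_j = 𝖡_{m²}` for
  `m² > 0` (any `d ≥ 1`, `L > 1`; the source has `d = 4`), with the corollaries `summable_betaPT`,
  `sum_range_betaPT_le` (`Σ_{j<k}β_j ≤ 𝖡_{m²}`), `betaPT_le_freeBubble`, `tendsto_betaPT_atTop`
  (`β_j → 0` for `m² > 0`).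

Locators: §6.1 by section and display content (the display defining `β_j`, `w_j`), Lemma 8.3.1 by
number (display numbers inside §4–§8 are not legible in the held text).
-/

noncomputable section

open MeasureTheory Set Filter Topology
open Literature.Probability.LatticeModels
open scoped BigOperators Real

namespace Literature.Barriers.CriticalPhenomena

namespace CTWSAW

open LongRangePhi4 LongRangePhi4.FRD

variable {d : ℕ}

/-! ### The printed definitions: `w_j` and `β_j` for the explicit decomposition -/

/-- **`w_{j,x} = Σ_{i=1}^j C_{i;0,x}`**, the partial sums of the finite-range decomposition
`(C_i)_{i≥1}` of `(-Δ_{ℤ^d}+m²)⁻¹` (the tree's `LongRangePhi4.FRD.Gam d L m² i`, i.e. BBS's `C_i`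
for the construction of [Baue13a] / the book, Ch. 3); `w_0 = 0`.
[cite: BauerschmidtBrydgesSlade2015LogCorr, §6.1 (display defining β_j and w_{j,x} = Σ_{i=1}^j C_{i;0,x})] -/
def covSum (d : ℕ) (L m2 : ℝ) (j : ℕ) (x : Site d) : ℝ :=
  ∑ i ∈ Finset.range j, Gam d L m2 (i + 1) x

/-- **`β_j = 8 Σ_{x∈ℤ^d} (w_{j+1,x}² - w_{j,x}²)`** (`j ≥ 0`), the sequence of §6.1 / [BBS-rg-pt] for
the explicit decomposition (the `m²`-dependence, suppressed in the source's notation, is the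
argument `m2`; `L` is the scale ratio of the decomposition).
[cite: BauerschmidtBrydgesSlade2015LogCorr, §6.1 (display β_j = 8Σ_{x∈ℤ^d}(w_{j+1,x}² - w_{j,x}²))] -/
def betaPT (d : ℕ) (L m2 : ℝ) (j : ℕ) : ℝ :=
  8 * ∑' x : Site d, (covSum d L m2 (j + 1) x ^ 2 - covSum d L m2 j x ^ 2)

/-- `w_0 = 0`. [cite: BauerschmidtBrydgesSlade2015LogCorr, §6.1 (w_{j,x} = Σ_{i=1}^j C_{i;0,x}, empty sum at j = 0)] -/
@[simp] theorem covSum_zero (L m2 : ℝ) (x : Site d) : covSum d L m2 0 x = 0 := by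
  simp [covSum]

/-- `w_{j+1} = w_j + C_{j+1}`. [cite: BauerschmidtBrydgesSlade2015LogCorr, §6.1 (w_{j,x} = Σ_{i=1}^j C_{i;0,x})] -/
theorem covSum_succ (L m2 : ℝ) (j : ℕ) (x : Site d) :
    covSum d L m2 (j + 1) x = covSum d L m2 j x + Gam d L m2 (j + 1) x := by
  simp [covSum, Finset.sum_range_succ]

/-- `w_j(-x) = w_j(x)` (each `C_i` is even). [folklore] -/
theorem covSum_neg (L m2 : ℝ) (j : ℕ) (x : Site d) : covSum d L m2 j (-x) = covSum d L m2 j x := by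
  simp [covSum, Gam_neg]

/-- **Finite range of `w_j`**: `w_{j,x} = 0` for `|x|₁ ≥ ½L^j` (`d ≥ 1`, `L ≥ 1`, `m² ≥ 0`), from the
finite-range property `C_{i;0,x} = 0` for `|x|₁ ≥ ½L^i` of each term (`i ≤ j`).
[cite: BauerschmidtBrydgesSlade2015LogCorr, §5.1 (display C_{j;x,y} = 0 if |x-y| ≥ ½L^j)] -/
theorem covSum_eq_zero (hd : 1 ≤ d) {L : ℝ} (hL : 1 ≤ L) {m2 : ℝ} (hm : 0 ≤ m2) {j : ℕ}
    {x : Site d} (hx : L ^ j / 2 ≤ ((∑ i, (x i).natAbs : ℕ) : ℝ)) : covSum d L m2 j x = 0 := by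
  unfold covSum
  refine Finset.sum_eq_zero fun i hi => ?_
  have hij : i + 1 ≤ j := Finset.mem_range.1 hi
  have hpow : L ^ (i + 1) ≤ L ^ j := pow_le_pow_right₀ hL hij
  exact Gam_eq_zero hd (zero_le_one.trans hL) hm (i + 1) x (le_trans (by linarith) hx)

/-- The sum over `ℤ^d` in `β_j` is a finite sum: over any `ℓ¹`-ball of radius `R ≥ ½L^{j+1}`.
[cite: BauerschmidtBrydgesSlade2015LogCorr, §6.1 (definition of β_j) and §5.1 (finite range)] -/
theorem tsum_sq_sub_sq_eq_sum (hd : 1 ≤ d) {L : ℝ} (hL : 1 ≤ L) {m2 : ℝ} (hm : 0 ≤ m2) (j : ℕ)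
    {R : ℝ} (hR : L ^ (j + 1) / 2 ≤ R) :
    ∑' x : Site d, (covSum d L m2 (j + 1) x ^ 2 - covSum d L m2 j x ^ 2) =
      ∑ x ∈ PT.ball R, (covSum d L m2 (j + 1) x ^ 2 - covSum d L m2 j x ^ 2) := by
  refine tsum_eq_sum fun x hx => ?_
  rw [PT.mem_ball, not_lt] at hx
  have h1 : L ^ (j + 1) / 2 ≤ ((∑ i, (x i).natAbs : ℕ) : ℝ) := hR.trans hx
  have hpow : L ^ j ≤ L ^ (j + 1) := pow_le_pow_right₀ hL (Nat.le_succ j)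
  have h0 : L ^ j / 2 ≤ ((∑ i, (x i).natAbs : ℕ) : ℝ) := le_trans (by linarith) h1
  rw [covSum_eq_zero hd hL hm h1, covSum_eq_zero hd hL hm h0]
  ring

/-- `Σ_{x∈ℤ^d} w_k(x)²` is a finite sum: over any `ℓ¹`-ball of radius `R ≥ ½L^k`.
[cite: BauerschmidtBrydgesSlade2015LogCorr, Lemma 8.3.1 (proof, the display Σ_{j<k}β_j = 8Σ_x w_k(x)²)] -/
theorem tsum_covSum_sq_eq_sum (hd : 1 ≤ d) {L : ℝ} (hL : 1 ≤ L) {m2 : ℝ} (hm : 0 ≤ m2) (k : ℕ)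
    {R : ℝ} (hR : L ^ k / 2 ≤ R) :
    ∑' x : Site d, covSum d L m2 k x ^ 2 = ∑ x ∈ PT.ball R, covSum d L m2 k x ^ 2 := by
  refine tsum_eq_sum fun x hx => ?_
  rw [PT.mem_ball, not_lt] at hx
  rw [covSum_eq_zero hd hL hm (hR.trans hx)]
  ring

/-! ### "`Σ_{j=0}^{k-1} β_j = 8 Σ_x w_k(x)²`, since the left-hand side is a telescoping sum" -/

/-- **`Σ_{j=0}^{k-1} β_j = 8 Σ_{|x|₁<R} w_k(x)²`** for any `R ≥ ½L^k` (telescoping, `w_0 = 0`).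
[cite: BauerschmidtBrydgesSlade2015LogCorr, Lemma 8.3.1 (proof, first display)] -/
theorem sum_range_betaPT (hd : 1 ≤ d) {L : ℝ} (hL : 1 ≤ L) {m2 : ℝ} (hm : 0 ≤ m2) (k : ℕ)
    {R : ℝ} (hR : L ^ k / 2 ≤ R) :
    ∑ j ∈ Finset.range k, betaPT d L m2 j = 8 * ∑ x ∈ PT.ball R, covSum d L m2 k x ^ 2 := by
  have hj : ∀ j ∈ Finset.range k, betaPT d L m2 j =
      8 * ∑ x ∈ PT.ball R, (covSum d L m2 (j + 1) x ^ 2 - covSum d L m2 j x ^ 2) := by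
    intro j hj
    have hjk : j + 1 ≤ k := Finset.mem_range.1 hj
    have hpow : L ^ (j + 1) ≤ L ^ k := pow_le_pow_right₀ hL hjk
    unfold betaPT
    rw [tsum_sq_sub_sq_eq_sum hd hL hm j (le_trans (by linarith) hR)]
  rw [Finset.sum_congr rfl hj, ← Finset.mul_sum, Finset.sum_comm]
  congr 1
  refine Finset.sum_congr rfl fun x _ => ?_
  have h := Finset.sum_range_sub (fun j => covSum d L m2 j x ^ 2) k
  simp only [covSum_zero] at h
  rw [h]
  ring

/-- **`Σ_{j=0}^{k-1} β_j = 8 Σ_{x∈ℤ^d} w_k(x)²`** — the telescoped form as printed.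
[cite: BauerschmidtBrydgesSlade2015LogCorr, Lemma 8.3.1 (proof, first display)] -/
theorem sum_range_betaPT_eq_tsum (hd : 1 ≤ d) {L : ℝ} (hL : 1 ≤ L) {m2 : ℝ} (hm : 0 ≤ m2)
    (k : ℕ) :
    ∑ j ∈ Finset.range k, betaPT d L m2 j = 8 * ∑' x : Site d, covSum d L m2 k x ^ 2 := by
  rw [sum_range_betaPT hd hL hm k le_rfl, tsum_covSum_sq_eq_sum hd hL hm k le_rfl]

/-! ### The Fourier side: `Ĉ_j ≥ 0`, `ŵ_k = Σ_{i≤k} Ĉ_i`, `0 ≤ ŵ_k ↑ Ĉ = 1/(λ+m²)` -/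

/-- The Fourier transform of `C_j`: `Ĉ_j(p) = ∫_{J_j} ŵ(t,p) dt/t` over the `j`-th scale interval
(`J_1 = (0,½L]`, `J_j = (½L^{j-1},½L^j]`), `ŵ(t,p) ≥ 0` being the Fourier side of the kernel
`w(t,x)` of the construction (`LongRangePhi4.FRD.wHat`). That this is `Σ_x C_{j;0,x}cos(p·x)` is
`cosSeries_Gam` below. [cite: BauerschmidtBrydgesSlade2015LogCorr, Lemma 8.3.1 (proof: "the Fourier transforms satisfy 0 ≤ ŵ_k ≤ Ĉ")] -/
def GamHat (d : ℕ) (L m2 : ℝ) (j : ℕ) (p : Fin d → ℝ) : ℝ :=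
  ∫ t in Ioc (scaleLower L j) (L ^ j / 2), wHat d m2 t p / t

/-- `ŵ_k(p) = Σ_{i=1}^k Ĉ_i(p)`, the Fourier transform of `w_k`.
[cite: BauerschmidtBrydgesSlade2015LogCorr, Lemma 8.3.1 (proof, the Fourier transforms ŵ_k)] -/
def covSumHat (d : ℕ) (L m2 : ℝ) (k : ℕ) (p : Fin d → ℝ) : ℝ :=
  ∑ i ∈ Finset.range k, GamHat d L m2 (i + 1) p

/-- `Ĉ_j(p) ≥ 0` ("the terms in the covariance decomposition are positive definite": `ŵ ≥ 0`).
[cite: BauerschmidtBrydgesSlade2015LogCorr, Lemma 8.3.1 (proof, 0 ≤ ŵ_k)] -/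
theorem GamHat_nonneg {L : ℝ} (hL : 0 ≤ L) {m2 : ℝ} (hm : 0 ≤ m2) (j : ℕ) (p : Fin d → ℝ) :
    0 ≤ GamHat d L m2 j p := by
  unfold GamHat
  refine setIntegral_nonneg measurableSet_Ioc fun t ht => ?_
  exact div_nonneg (wHat_nonneg hm t p) ((scaleLower_nonneg hL j).trans ht.1.le)

/-- **`Σ_{j≥1} Ĉ_j(p) = Ĉ(p) = 1/(λ(p)+m²)`** (`m² > 0`, `L > 1`): the scale integrals of `ŵ(t,p)dt/t`
over the partition of `(0,∞)` add up to `∫₀^∞ ŵ(t,p)dt/t = 1/(λ(p)+m²)`.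
[cite: BauerschmidtBrydgesSlade2015LogCorr, §5.1 (display (-Δ_{ℤ^d}+m²)⁻¹ = Σ_{j=1}^∞ C_j) and Lemma 8.3.1 (proof, ŵ_k ≤ Ĉ)] -/
theorem hasSum_GamHat {L : ℝ} (hL : 1 < L) {m2 : ℝ} (hm : 0 < m2) (p : Fin d → ℝ) :
    HasSum (fun m : ℕ => GamHat d L m2 (m + 1) p) (1 / (laplaceSymbol p + m2)) := by
  have h := hasSum_integral_iUnion (μ := (volume : Measure ℝ)) (f := fun t => wHat d m2 t p / t)
    (fun m => measurableSet_Ioc) (pairwise_disjoint_scaleIoc hL.le)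
    (by rw [iUnion_scaleIoc hL]; exact integrableOn_wHat_div hm p)
  rw [iUnion_scaleIoc hL, integral_wHat_div hm p] at h
  refine h.congr_fun fun m => ?_
  unfold GamHat
  rw [scaleLower_succ, scalePoint_succ]

/-- `ŵ_{k+1} = ŵ_k + Ĉ_{k+1}`. [cite: BauerschmidtBrydgesSlade2015LogCorr, Lemma 8.3.1 (proof, ŵ_k)] -/
theorem covSumHat_succ (L m2 : ℝ) (k : ℕ) (p : Fin d → ℝ) :
    covSumHat d L m2 (k + 1) p = covSumHat d L m2 k p + GamHat d L m2 (k + 1) p := by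
  simp [covSumHat, Finset.sum_range_succ]

/-- **`0 ≤ ŵ_k`**. [cite: BauerschmidtBrydgesSlade2015LogCorr, Lemma 8.3.1 (proof, "0 ≤ ŵ_k ≤ Ĉ")] -/
theorem covSumHat_nonneg {L : ℝ} (hL : 0 ≤ L) {m2 : ℝ} (hm : 0 ≤ m2) (k : ℕ) (p : Fin d → ℝ) :
    0 ≤ covSumHat d L m2 k p :=
  Finset.sum_nonneg fun i _ => GamHat_nonneg hL hm (i + 1) p

/-- `ŵ_k ≤ ŵ_{k+1}`. [cite: BauerschmidtBrydgesSlade2015LogCorr, Lemma 8.3.1 (proof, positivity of the terms)] -/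
theorem covSumHat_le_succ {L : ℝ} (hL : 0 ≤ L) {m2 : ℝ} (hm : 0 ≤ m2) (k : ℕ) (p : Fin d → ℝ) :
    covSumHat d L m2 k p ≤ covSumHat d L m2 (k + 1) p := by
  rw [covSumHat_succ]
  exact le_add_of_nonneg_right (GamHat_nonneg hL hm (k + 1) p)

/-- `k ↦ ŵ_k(p)` is non-decreasing. [cite: BauerschmidtBrydgesSlade2015LogCorr, Lemma 8.3.1 (proof, positivity of the terms)] -/
theorem covSumHat_mono {L : ℝ} (hL : 0 ≤ L) {m2 : ℝ} (hm : 0 ≤ m2) (p : Fin d → ℝ) :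
    Monotone fun k => covSumHat d L m2 k p :=
  monotone_nat_of_le_succ fun k => covSumHat_le_succ hL hm k p

/-- **`ŵ_k ≤ Ĉ = 1/(λ+m²)`** (`m² > 0`, `L > 1`).
[cite: BauerschmidtBrydgesSlade2015LogCorr, Lemma 8.3.1 (proof, "0 ≤ ŵ_k ≤ Ĉ")] -/
theorem covSumHat_le {L : ℝ} (hL : 1 < L) {m2 : ℝ} (hm : 0 < m2) (k : ℕ) (p : Fin d → ℝ) :
    covSumHat d L m2 k p ≤ 1 / (laplaceSymbol p + m2) :=
  sum_le_hasSum (Finset.range k) (fun i _ => GamHat_nonneg (zero_le_one.trans hL.le) hm.le (i + 1) p)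
    (hasSum_GamHat hL hm p)

/-- `ŵ_k(p) → Ĉ(p)` as `k → ∞`. [cite: BauerschmidtBrydgesSlade2015LogCorr, Lemma 8.3.1 (proof, the limit k → ∞)] -/
theorem tendsto_covSumHat {L : ℝ} (hL : 1 < L) {m2 : ℝ} (hm : 0 < m2) (p : Fin d → ℝ) :
    Tendsto (fun k => covSumHat d L m2 k p) atTop (𝓝 (1 / (laplaceSymbol p + m2))) :=
  (hasSum_GamHat hL hm p).tendsto_sum_nat

/-- `Ĉ(p) = 1/(λ(p)+m²) ≤ 1/m²`. [folklore] -/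
theorem one_div_laplaceSymbol_add_le {m2 : ℝ} (hm : 0 < m2) (p : Fin d → ℝ) :
    1 / (laplaceSymbol p + m2) ≤ 1 / m2 :=
  one_div_le_one_div_of_le hm (le_add_of_nonneg_left (laplaceSymbol_nonneg p))

/-! ### Fourier inversion: `Σ_x C_{j;0,x}cos(p·x) = Ĉ_j(p)` and `Σ_x w_k(x)cos(p·x) = ŵ_k(p)` -/

/-- **`Σ_{|x|₁<R} C_{j;0,x} cos(p·x) = Ĉ_j(p)`** for `R > ½L^j` (`m² > 0`): the finite sum passes
inside the scale integral, where `Σ_x w(t,x)cos(p·x) = ŵ(t,p)` for `t ≤ ½L^j < R`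
(`LongRangePhi4.FRD.wHat_eq_sum_wKer_mul_cos`). [cite: BauerschmidtBrydgesSlade2015LogCorr, Lemma 8.3.1 (proof, the Fourier transforms of the C_j)] -/
theorem cosSeries_Gam (hd : 1 ≤ d) {L : ℝ} (hL : 0 ≤ L) {m2 : ℝ} (hm : 0 < m2) (j : ℕ) {R : ℝ}
    (hR : L ^ j / 2 < R) (p : Fin d → ℝ) :
    cosSeries (Gam d L m2 j) (PT.ball R) p = GamHat d L m2 j p := by
  unfold cosSeries GamHat Gam
  have hlo : 0 ≤ scaleLower L j := scaleLower_nonneg hL j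
  have hint : ∀ x ∈ PT.ball R, IntegrableOn
      (fun t : ℝ => wKer d m2 t x / t * Real.cos (phase p x)) (Ioc (scaleLower L j) (L ^ j / 2)) :=
    fun x _ => (integrableOn_wKer_div_Ioc hm x hlo).mul_const _
  calc ∑ x ∈ PT.ball R, (∫ t in Ioc (scaleLower L j) (L ^ j / 2), wKer d m2 t x / t) *
          Real.cos (phase p x)
      = ∑ x ∈ PT.ball R, ∫ t in Ioc (scaleLower L j) (L ^ j / 2),
          wKer d m2 t x / t * Real.cos (phase p x) := by
        refine Finset.sum_congr rfl fun x _ => ?_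
        rw [← integral_mul_const]
    _ = ∫ t in Ioc (scaleLower L j) (L ^ j / 2), ∑ x ∈ PT.ball R,
          wKer d m2 t x / t * Real.cos (phase p x) := by
        rw [integral_finsetSum _ hint]
    _ = ∫ t in Ioc (scaleLower L j) (L ^ j / 2), wHat d m2 t p / t := by
        refine setIntegral_congr_fun measurableSet_Ioc fun t ht => ?_
        have ht0 : 0 < t := lt_of_le_of_lt hlo ht.1
        have hfl : (⌊t⌋₊ : ℝ) < R := lt_of_le_of_lt ((Nat.floor_le ht0.le).trans ht.2) hR
        rw [wHat_eq_sum_wKer_mul_cos hd hm ht0 hfl p, Finset.sum_div]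
        refine Finset.sum_congr rfl fun x _ => ?_
        ring

/-- **`Σ_{|x|₁<R} w_k(x) cos(p·x) = ŵ_k(p)`** for `R > ½L^k` (`m² > 0`, `L ≥ 1`).
[cite: BauerschmidtBrydgesSlade2015LogCorr, Lemma 8.3.1 (proof, the Fourier transforms ŵ_k)] -/
theorem cosSeries_covSum (hd : 1 ≤ d) {L : ℝ} (hL : 1 ≤ L) {m2 : ℝ} (hm : 0 < m2) (k : ℕ)
    {R : ℝ} (hR : L ^ k / 2 < R) (p : Fin d → ℝ) :
    cosSeries (covSum d L m2 k) (PT.ball R) p = covSumHat d L m2 k p := by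
  have hL0 : 0 ≤ L := zero_le_one.trans hL
  have h1 : cosSeries (covSum d L m2 k) (PT.ball R) p =
      ∑ i ∈ Finset.range k, cosSeries (Gam d L m2 (i + 1)) (PT.ball R) p := by
    unfold cosSeries covSum
    rw [Finset.sum_comm]
    refine Finset.sum_congr rfl fun x _ => ?_
    rw [Finset.sum_mul]
  rw [h1]
  unfold covSumHat
  refine Finset.sum_congr rfl fun i hi => cosSeries_Gam hd hL0 hm (i + 1) (lt_of_le_of_lt ?_ hR) p
  have hik : i + 1 ≤ k := Finset.mem_range.1 hi
  have hpow : L ^ (i + 1) ≤ L ^ k := pow_le_pow_right₀ hL hik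
  linarith

/-- `p ↦ ŵ_k(p)` is continuous (a trigonometric polynomial). [folklore] -/
theorem continuous_covSumHat (hd : 1 ≤ d) {L : ℝ} (hL : 1 ≤ L) {m2 : ℝ} (hm : 0 < m2) (k : ℕ) :
    Continuous fun p => covSumHat d L m2 k p := by
  have h : (fun p => covSumHat d L m2 k p) = cosSeries (covSum d L m2 k) (PT.ball (L ^ k / 2 + 1)) := by
    funext p
    rw [cosSeries_covSum hd hL hm k (lt_add_one _) p]
  rw [h]
  exact continuous_cosSeries _ _

/-- `p ↦ ŵ_k(p)²` is integrable on `[-π,π]^d`. [folklore] -/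
theorem integrableOn_covSumHat_sq (hd : 1 ≤ d) {L : ℝ} (hL : 1 ≤ L) {m2 : ℝ} (hm : 0 < m2)
    (k : ℕ) : IntegrableOn (fun p => covSumHat d L m2 k p ^ 2) (brillouin d) :=
  LongRangePhi4.integrableOn_brillouin_of_continuous ((continuous_covSumHat hd hL hm k).pow 2)

/-! ### "By the Parseval relation": `Σ_x w_k(x)² = ∫_{[-π,π]^d} ŵ_k(p)² dp/(2π)^d` -/

/-- **Parseval**: `Σ_{|x|₁<R} w_k(x)² = (2π)^{-d}∫_{[-π,π]^d} ŵ_k(p)² dp` for `R > ½L^k` (the sum is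
all of `Σ_{x∈ℤ^d}` by `tsum_covSum_sq_eq_sum`). [cite: BauerschmidtBrydgesSlade2015LogCorr, Lemma 8.3.1 (proof, "By the Parseval relation")] -/
theorem sum_covSum_sq_eq (hd : 1 ≤ d) {L : ℝ} (hL : 1 ≤ L) {m2 : ℝ} (hm : 0 < m2) (k : ℕ)
    {R : ℝ} (hR : L ^ k / 2 < R) :
    ∑ x ∈ PT.ball R, covSum d L m2 k x ^ 2 =
      ((2 * π) ^ d : ℝ)⁻¹ * ∫ p in brillouin d, covSumHat d L m2 k p ^ 2 := by
  have h := sum_mul_eq_setIntegral_cosSeries (PT.ball R) (fun x hx => neg_mem_ball x hx)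
    (covSum d L m2 k) (covSum d L m2 k) (fun x => covSum_neg L m2 k x)
  have e1 : ∑ x ∈ PT.ball R, covSum d L m2 k x ^ 2 =
      ∑ x ∈ PT.ball R, covSum d L m2 k x * covSum d L m2 k x :=
    Finset.sum_congr rfl fun x _ => sq _
  rw [e1, h]
  congr 1
  refine setIntegral_congr_fun (measurableSet_brillouin d) fun p _ => ?_
  rw [cosSeries_covSum hd hL hm k hR p, sq]

/-- **`β_j = 8 (2π)^{-d} ∫_{[-π,π]^d} (ŵ_{j+1}(p)² - ŵ_j(p)²) dp`** (`m² > 0`).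
[cite: BauerschmidtBrydgesSlade2015LogCorr, §6.1 (definition of β_j) and Lemma 8.3.1 (proof, Parseval)] -/
theorem betaPT_eq_integral (hd : 1 ≤ d) {L : ℝ} (hL : 1 ≤ L) {m2 : ℝ} (hm : 0 < m2) (j : ℕ) :
    betaPT d L m2 j = 8 * (((2 * π) ^ d : ℝ)⁻¹ *
      ∫ p in brillouin d, (covSumHat d L m2 (j + 1) p ^ 2 - covSumHat d L m2 j p ^ 2)) := by
  have hR1 : L ^ (j + 1) / 2 < L ^ (j + 1) / 2 + 1 := lt_add_one _
  have hpow : L ^ j ≤ L ^ (j + 1) := pow_le_pow_right₀ hL (Nat.le_succ j)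
  have hR0 : L ^ j / 2 < L ^ (j + 1) / 2 + 1 := by linarith
  unfold betaPT
  rw [tsum_sq_sub_sq_eq_sum hd hL hm.le j hR1.le, Finset.sum_sub_distrib,
    sum_covSum_sq_eq hd hL hm (j + 1) hR1, sum_covSum_sq_eq hd hL hm j hR0, ← mul_sub,
    ← integral_sub (integrableOn_covSumHat_sq hd hL hm (j + 1)) (integrableOn_covSumHat_sq hd hL hm j)]

/-- **`β_j ≥ 0`** (`m² > 0`, `L > 1`): `ŵ_{j+1} ≥ ŵ_j ≥ 0` pointwise. The source states `β_j > 0`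
("since each `C_i` is positive-definite"); the non-strict form is what Lemma 8.3.1 needs.
[cite: BauerschmidtBrydgesSlade2015LogCorr, §6.1 ("the above definition implies that β_j > 0 for all j")] -/
theorem betaPT_nonneg (hd : 1 ≤ d) {L : ℝ} (hL : 1 < L) {m2 : ℝ} (hm : 0 < m2) (j : ℕ) :
    0 ≤ betaPT d L m2 j := by
  have hL0 : 0 ≤ L := zero_le_one.trans hL.le
  rw [betaPT_eq_integral hd hL.le hm j]
  refine mul_nonneg (by norm_num) (mul_nonneg (by positivity) ?_)
  refine setIntegral_nonneg (measurableSet_brillouin d) fun p _ => ?_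
  have h0 := covSumHat_nonneg (d := d) hL0 hm.le j p
  have h1 := covSumHat_le_succ (d := d) hL0 hm.le j p
  nlinarith

/-! ### "the dominated convergence theorem, and (1.8)": Lemma 8.3.1 -/

/-- (1.8) in the symbol `λ(k) = 4Σ_j sin²(k_j/2)`: **`𝖡_{m²} = 8 (2π)^{-d}∫_{[-π,π]^d} Ĉ(p)² dp`** with
`Ĉ(p) = 1/(λ(p)+m²)` ("`𝖡_{m²} = 8B_{m²}`", `B_{m²} = ∫Ĉ²dp/(2π)^d`).
[cite: BauerschmidtBrydgesSlade2015LogCorr, eq. (1.8) and Lemma 8.3.1 (proof, last display)] -/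
theorem freeBubble_eq_integral_laplaceSymbol (d : ℕ) (m2 : ℝ) :
    freeBubble d m2 =
      8 * (((2 * π) ^ d : ℝ)⁻¹ * ∫ p in brillouin d, (1 / (laplaceSymbol p + m2)) ^ 2) := by
  have hI : (∫ p in brillouin d, |1 / (4 * ∑ j, Real.sin (p j / 2) ^ 2 + m2)| ^ 2) =
      ∫ p in brillouin d, (1 / (laplaceSymbol p + m2)) ^ 2 := by
    refine setIntegral_congr_fun (measurableSet_brillouin d) fun p _ => ?_
    rw [laplaceSymbol_eq_four_mul_sum_sin_sq, sq_abs]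
  unfold freeBubble
  rw [hI, div_eq_inv_mul]

/-- **`∫_{[-π,π]^d} ŵ_k(p)² dp → ∫_{[-π,π]^d} Ĉ(p)² dp`** as `k → ∞` (`m² > 0`, `L > 1`): dominated
convergence with the bound `ŵ_k² ≤ Ĉ² ≤ m⁻⁴` on the compact Brillouin zone and `ŵ_k ↑ Ĉ` pointwise.
[cite: BauerschmidtBrydgesSlade2015LogCorr, Lemma 8.3.1 (proof, "the dominated converge theorem")] -/
theorem tendsto_integral_covSumHat_sq (hd : 1 ≤ d) {L : ℝ} (hL : 1 < L) {m2 : ℝ} (hm : 0 < m2) :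
    Tendsto (fun k => ∫ p in brillouin d, covSumHat d L m2 k p ^ 2) atTop
      (𝓝 (∫ p in brillouin d, (1 / (laplaceSymbol p + m2)) ^ 2)) := by
  have hL0 : 0 ≤ L := zero_le_one.trans hL.le
  haveI : IsFiniteMeasure ((volume : Measure (Fin d → ℝ)).restrict (brillouin d)) :=
    isFiniteMeasure_restrict.2 (isCompact_brillouin d).measure_lt_top.ne
  refine tendsto_integral_of_dominated_convergence (fun _ => (1 / m2) ^ 2)
    (fun k => ((continuous_covSumHat hd hL.le hm k).pow 2).aestronglyMeasurable)
    (integrable_const _) (fun k => ae_of_all _ fun p => ?_) (ae_of_all _ fun p => ?_)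
  · rw [Real.norm_eq_abs, abs_of_nonneg (sq_nonneg _)]
    exact pow_le_pow_left₀ (covSumHat_nonneg hL0 hm.le k p)
      ((covSumHat_le hL hm k p).trans (one_div_laplaceSymbol_add_le hm p)) 2
  · exact (tendsto_covSumHat hL hm p).pow 2

/-- **`Σ_{j=0}^{k-1} β_j → 𝖡_{m²}`** as `k → ∞` (`m² > 0`, `L > 1`, `d ≥ 1`): telescoping, Parseval,
dominated convergence and (1.8). [cite: BauerschmidtBrydgesSlade2015LogCorr, Lemma 8.3.1 (proof)] -/
theorem tendsto_sum_range_betaPT (hd : 1 ≤ d) {L : ℝ} (hL : 1 < L) {m2 : ℝ} (hm : 0 < m2) :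
    Tendsto (fun k => ∑ j ∈ Finset.range k, betaPT d L m2 j) atTop (𝓝 (freeBubble d m2)) := by
  have hkey : (fun k => ∑ j ∈ Finset.range k, betaPT d L m2 j) = fun k =>
      8 * (((2 * π) ^ d : ℝ)⁻¹ * ∫ p in brillouin d, covSumHat d L m2 k p ^ 2) := by
    funext k
    have hR : L ^ k / 2 < L ^ k / 2 + 1 := lt_add_one _
    rw [sum_range_betaPT hd hL.le hm.le k hR.le, sum_covSum_sq_eq hd hL.le hm k hR]
  rw [hkey, freeBubble_eq_integral_laplaceSymbol]
  exact ((tendsto_integral_covSumHat_sq hd hL hm).const_mul _).const_mul _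

/-- **BBS 2015, Lemma 8.3.1** (for the explicit decomposition, any `d ≥ 1` and scale ratio `L > 1`;
the source has `d = 4`): for `m² > 0`, **`Σ_{j=0}^∞ β_j = 𝖡_{m²}`**, as a convergent series of
nonnegative terms with sum `CTWSAW.freeBubble d m²` (the `𝖡_{m²}` of (1.8) and Theorem 4.1).
[cite: BauerschmidtBrydgesSlade2015LogCorr, Lemma 8.3.1] -/
theorem hasSum_betaPT (hd : 1 ≤ d) {L : ℝ} (hL : 1 < L) {m2 : ℝ} (hm : 0 < m2) :
    HasSum (betaPT d L m2) (freeBubble d m2) :=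
  (hasSum_iff_tendsto_nat_of_nonneg (fun j => betaPT_nonneg hd hL hm j) _).2
    (tendsto_sum_range_betaPT hd hL hm)

/-- **BBS 2015, Lemma 8.3.1**, `tsum` form: for `m² > 0`, `Σ_{j=0}^∞ β_j = 𝖡_{m²}`.
[cite: BauerschmidtBrydgesSlade2015LogCorr, Lemma 8.3.1] -/
theorem BBS2015_lem831 (hd : 1 ≤ d) {L : ℝ} (hL : 1 < L) {m2 : ℝ} (hm : 0 < m2) :
    ∑' j, betaPT d L m2 j = freeBubble d m2 :=
  (hasSum_betaPT hd hL hm).tsum_eq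

/-- `(β_j)` is summable for `m² > 0`. [cite: BauerschmidtBrydgesSlade2015LogCorr, Lemma 8.3.1] -/
theorem summable_betaPT (hd : 1 ≤ d) {L : ℝ} (hL : 1 < L) {m2 : ℝ} (hm : 0 < m2) :
    Summable (betaPT d L m2) :=
  (hasSum_betaPT hd hL hm).summable

/-- `Σ_{j=0}^{k-1} β_j ≤ 𝖡_{m²}` (`m² > 0`): partial sums of nonnegative terms.
[cite: BauerschmidtBrydgesSlade2015LogCorr, Lemma 8.3.1] -/
theorem sum_range_betaPT_le (hd : 1 ≤ d) {L : ℝ} (hL : 1 < L) {m2 : ℝ} (hm : 0 < m2) (k : ℕ) :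
    ∑ j ∈ Finset.range k, betaPT d L m2 j ≤ freeBubble d m2 :=
  sum_le_hasSum (Finset.range k) (fun j _ => betaPT_nonneg hd hL hm j) (hasSum_betaPT hd hL hm)

/-- `β_j ≤ 𝖡_{m²}` for every `j` (`m² > 0`); in particular `(β_j)` is bounded, the `m² > 0` case of
"The sequence `(β_j)` is bounded" in Assumption (A1).
[cite: BauerschmidtBrydgesSlade2015LogCorr, Lemma 8.3.1 and §6.1, Assumption (A1)] -/
theorem betaPT_le_freeBubble (hd : 1 ≤ d) {L : ℝ} (hL : 1 < L) {m2 : ℝ} (hm : 0 < m2) (j : ℕ) :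
    betaPT d L m2 j ≤ freeBubble d m2 := by
  have h := sum_range_betaPT_le hd hL hm (j + 1)
  rw [Finset.sum_range_succ] at h
  linarith [Finset.sum_nonneg fun i (_ : i ∈ Finset.range j) => betaPT_nonneg hd hL hm i]

/-- `β_j → 0` as `j → ∞` for `m² > 0` ("for `m² > 0` … `β_j` decays … to `0`"; here only the
qualitative consequence of summability, not the rate). [cite: BauerschmidtBrydgesSlade2015LogCorr, §6.1 ("for m² > 0, by (scaling-estimate), β_j decays extremely rapidly to 0 for j ≥ j_m")] -/
theorem tendsto_betaPT_atTop (hd : 1 ≤ d) {L : ℝ} (hL : 1 < L) {m2 : ℝ} (hm : 0 < m2) :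
    Tendsto (betaPT d L m2) atTop (𝓝 0) :=
  (summable_betaPT hd hL hm).tendsto_atTop_zero

end CTWSAW

end Literature.Barriers.CriticalPhenomena
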